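import Mathlib
import HarnessLib
import HarnessLib.Audit
import Summits.AnomalousDissipation.Statement
import Literature.Analysis.FunctionSpaces.TorusPlanarLift
import Literature.Analysis.FluidPDE.PassiveScalarForced
import Literature.Analysis.FluidPDE.PassiveScalar
import HarnessLib.Audit.Status.Attr

/-!
Route: TwoAndHalfD

It suffices to show X = the zeroth law INSIDE the x₃-invariant ("two-and-a-half-dimensional") class:
one steady, smooth,
ν-independent, divergence-free, mean-zero force f = (g₁,g₂,h)(x₁,x₂) on T³ and, along ν_j → 0,
x₃-invariant global
Leray–Hopf solutions u_j = (v_j, w_j)(t,x₁,x₂) with ν-uniformly bounded limsup-mean energy and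
limsup-mean dissipation
≥ ε > 0. In this class v_j solves 2-D Navier–Stokes forced by g = (g₁,g₂) and w_j is a passive
scalar with the steady
source h advected by v_j at Prandtl number 1; planar energy dissipation is O(ν^{1/2}) at bounded
energy
[AlexakisDoering2006PLA], so ALL the anomaly sits in the scalar component — "anomalous scalar
dissipation with a steady
source in steadily forced 2-D turbulence" (crux #2 ScalarAnomalySteadySourceFormal, which quantifies
its own bounded-energy
planar Leray–Hopf family), with the honest in-class negation TwohalfdNeg as #5. The zero-momentum
planar energy bound
TwodBoundedEnergyZeroMomentum (former #3, stmt-AnomalousDissipation-10786) is a necessary-direction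
PROBE of #2's planar
half, not a hypothesis of anything that reaches X; it was dropped as an item at rev 8 (unused-crux
repair) and is recorded
under KILL CRITERIA.
Lean: `TwohalfdThesis` — `Literature.Turb.ZerothLaw` with the two extra conjuncts `∀ s x, f (x +
Pi.single 2 s) = f x`
and `∀ j t s x, u j t (x + Pi.single 2 s) = u j t x`.
Deciding theorem (D-0027 §2.1, rev 4, unchanged): `closes : TwohalfdThesis → AnomalousDissipation` —
drop the two invariance
conjuncts (two lines; axioms propext / Classical.choice / Quot.sound); the item `Assembly :=
TwohalfdThesis →
AnomalousDissipation` is the same implication. Cone of `closes` after rev 9 (route-choice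
2026-08-16): TwohalfdThesis ⇐ ScalarLiftGlueR
(ScalarAnomalySteadySourceFormal → SourcedScalarUnique2D → ScalarLift2halfDR → TwohalfdThesis). The
rev-6 pair
ScalarLift2halfD (stmt-AnomalousDissipation-14324, refuted-MISSTATED by
Theorems.not_ScalarLift2halfD: the planar Leray–Hopf
class does not pin an unconstrained datum v₀ — a non-measurable junk datum satisfies it) and
ScalarLiftGlue (14325, proved,
now vacuous) is retired; the repaired lift ScalarLift2halfDR restarts the pair (v, θ) at a good time
s ≥ 0, where the datum
(v s, θ s) is honest, and limsup means do not see the translation.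

Rationale: WHY THIS LINE. The only setting in which anomalous dissipation for the FORCED Navier–Stokes system
is a theorem is the 2½-D
architecture — planar Navier–Stokes plus a transported third component: BrueDeLellis2023
(arXiv:2207.06301, Thm 1.1/3.1: ν-
and time-dependent forces on [0,1]), BCCDS2024 (arXiv:2212.08413, Onsager-critical),
arXiv:2409.03599 Thm 1.5 (autonomous but
ν-dependent data/forces on [0,1]) and Cheskidov2023 (arXiv:2311.04182 Thm 1.3: long-time averages,
time-periodic ν-dependent
f^ν → f); Bruè–De Lellis's Questions 2.1 (ν-independent force) and 2.2 (time-independent force),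
asked together in the
stationary long-time-average regime of the summit, are exactly X. Imported from passive-scalar
transport: the
anomalous-dissipation technology of DrivasEtAl2022 and ArmstrongVicol2025, and the 2-D phenomenology
in which a scalar cascades
forward with ν-independent dissipation while energy cascades inversely (CelaniEtAl2000). The
obstruction specific to STEADY
ν-independent forcing is the planar base flow: at zero momentum first-shell forcing is globally
laminar with energy ~ ν⁻²
(Marchioro1986 = Literature.Barriers.AnomalousDissipation.Marchioro1986_globalAttraction), bounded
stationary or
bounded-mean-energy families under a steady force are a printed open problem
(ConstantinTarfuleaVicol2013 p.3), and only DNS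
suggests a condensate saturating independently of ν (GalletYoung2013) — this planar prerequisite was
probed 2026-08-15/16 as
the item TwodBoundedEnergyZeroMomentum (stmt-AnomalousDissipation-10786) and DROPPED as an item at
rev 8 (it does not feed
`closes`; see RANKED CRUXES / KILL CRITERIA). Linear advection–diffusion turns #2 into a question
about mixing by the planar
velocity ensemble (spectral / enhanced-dissipation tools apply), not about 3-D regularity:
Leray–Hopf leakage is impossible in
this class (2½-D solutions are smooth for ν > 0).

RANKED CRUXES. #2 ScalarAnomalySteadySourceFormal — ∃ smooth mean-zero g (divergence free) and h on
T², ν_j → 0, 2-D global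
Leray–Hopf v_j (force g) with bounded limsup-mean energy, L² data and global weak solutions θ_j of
∂ₜθ + v_j·∇θ = ν_jΔθ + h
with sup_j limsup-mean ‖θ_j‖² < ∞ and limsup-mean ν_j‖∇θ_j‖² ≥ ε > 0 (why it might fail: v_j may
condense to a near-autonomous
large-scale state — autonomous weak-Sard planar fields carry no dissipation anomaly, BagnaraEtAl2026
= arXiv:2603.11466 Thm 1.2
and arXiv:2409.03599 Rem 1.2, and 2-D Hamiltonian flows only enhance diffusion at rate κ^{1/3},
arXiv:2211.14057 — then ⟨θ_j²⟩ ~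
ν^{-a} or ν⟨|∇θ_j|²⟩ → 0; refuter design constraint: g must span ≥ 2 shell radii, because
single-shell forcing keeps the planar
flow ν-uniformly in H¹ at bounded energy (Tran–Shepherd identity ⟨‖Δv‖²⟩ = λ⟨‖∇v‖²⟩) and the sourced
scalar then renormalises —
evidence SINGLE_SHELL_2HALFD.md on 0448; sources BrueDeLellis2023 Thm 3.1 + Q2.1–2.2,
arXiv:1911.11014,
Literature.Barriers.AnomalousDissipation.DrivasElgindiIyerJeong2022_thm4). #5 TwohalfdNeg — the
in-class negation: every
x₃-invariant bounded-energy Leray–Hopf family under an x₃-invariant steady smooth force has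
meanDissipation → 0 (why it might
fail: false iff X; ν-dependent-force anomalies exist in this very class — arXiv:2409.03599 Thm 1.5,
Cheskidov2023 Thm 1.3 =
Literature.Barriers.AnomalousDissipation.Cheskidov2023_thm13_not_forceRobustNoAnomaly — so a proof
must use exact steadiness and
ν-independence of f; the first-shell-planar-force sub-case has a paper proof, evidence
E1SUBCASE_0211.md). Target #0
TwohalfdThesis = X (auto-crux: the hypothesis of `closes`). Support: SymmetricLhExistence (#4,
proved:
symmetricLhExistence_proof); the crux→target GLUE CHAIN (rev 6, repaired rev 9; support, rank 9):
SourcedScalarUnique2D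
(stmt-AnomalousDissipation-14323: uniqueness of L^∞_t L²_x weak sourced scalars over a 2-D global
Leray–Hopf drift — duality in
the Prodi–Serrin class L⁴_{t,x}, or DiPerna–Lions renormalisation at Sobolev level: the drift is
L²_tH¹_x ⊂ L¹_tḢ¹_x on windows,
tree PassiveScalarUniquenessL1Sobolev.unique_of_lintegral_eGradNormSq_rpow_lt_top for the
homogeneous difference),
ScalarLift2halfDR (rev 9, REPAIRED lift in RESTART form: for ν > 0, g smooth divergence-free, h
smooth, θ₀ ∈ L² and a 2-D global
Leray–Hopf v from ANY datum v₀, the energy solution θ of the sourced scalar equation from θ₀ exists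
AND for some s ≥ 0 the
translated lift t ↦ twoHalf (v (t+s)) (θ (t+s)) is a 3-D global Leray–Hopf solution with force
twoHalf g h from the HONEST datum
twoHalf (v s) (θ s); tree: Torus.IsGlobalLerayHopf.exists_isGlobalLerayHopf_translate gives such s
for v), ScalarLiftGlueR (rev 9:
ScalarAnomalySteadySourceFormal → SourcedScalarUnique2D → ScalarLift2halfDR → TwohalfdThesis; the
landed scalarLiftGlue_proof plus
translation bookkeeping: IsGlobalLerayHopf.meanEnergy_translate, longTimeAvgSup_comp_add_right,
uniqueness applied on the
ORIGINAL time axis); Assembly := TwohalfdThesis → AnomalousDissipation (definitional; the deciding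
theorem `closes` proves it).
RETIRED AT REV 9 (route-choice after the refutation): ScalarLift2halfD (14324) — refuted-MISSTATED
by Theorems.not_ScalarLift2halfD
(witness ν = 1, g = h = 0, v ≡ 0, θ₀ = 1 and the NON-MEASURABLE planar datum v₀ = 𝟙_C e₀, C a
coordinate slab over a Vitali set:
Torus.IsLerayHopfOn sees the datum only through Bochner integrals, junk 0, and a lower integral, so
the hypothesis holds while
the lifted datum has junk kinetic energy 0; the prover's repaired C′ adds MemLp v₀ 2) — and
ScalarLiftGlue (14325, proved but
vacuous). LESSON (negative knowledge, junk level): crux #2 is existential with v₀ j unconstrained,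
so its witnesses may carry a
junk planar datum; nothing downstream may read v₀ j — the repaired chain restarts at a good time
instead of adding MemLp (v₀ j) 2
to #2 (which would re-key the staffed crux 0448 and its crux chain) or proving a 2-D Lions–Magenes
datum-normalisation lemma.
DROPPED AT REV 8 (unused-crux repair): former #3 TwodBoundedEnergyZeroMomentum (10786; ∃ g ≠ 0
smooth divergence-free mean-zero
on T², ν_j → 0, ZERO-MOMENTUM L² data, global Leray–Hopf v_j with sup_j limsup-mean energy < ∞ — the
bounded-energy half of the
open problem ConstantinTarfuleaVicol2013 p.3). It is implied neither by X nor by #2 (both allow any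
L² data) and implies
neither; the only item-level links to the cone of `closes` would be costume (`#3 → #2`, logically
weaker than #2 itself) or a
universal bridge 'every zero-momentum bounded-energy planar family anomalously dissipates SOME
steadily sourced scalar at
bounded variance', which is false on exactly the witnesses its crux chain was constructing: over a
STEADY planar branch V_j
(ν_j → 0) converging strongly in L² to a bounded H¹ divergence-free limit V̄ — the shape of every
surviving line
(v_ν = V + νv₁ + …, forced-Euler anchor V) — long-time means see only the steady scalar state θ_j^∞,
ν_j‖∇θ_j^∞‖² = ⟨h,θ_j^∞⟩,
a bounded-variance subsequence has θ_j^∞ ⇀ θ̄ with div(V̄θ̄) = h, and DiPerna–Lions renormalisation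
gives ⟨h,θ̄⟩ = 0: no
anomaly. Steady bounded branches therefore decide nothing about X. What the probe produced stays in
tree as negative
knowledge for #2's planar half: Theorems/TwodBoundedEnergyZeroMomentum/Negative/* — the whole first
Stokes eigenspace is rigid
(meanEnergy = ‖g‖²/(16π⁴ν²) for every zero-momentum Leray–Hopf solution under any first-shell force:
not_TwodBoundedEnergyZeroMomentum_firstMode / _forall_force, FirstShellGalerkin/Trilinear/General ⇒
a zero-momentum planar
family with bounded energy needs ĝ(k) ≠ 0 for some |k|² ≥ 2), single-shell forces give dissipation
O(ν_j) for EVERY Leray–Hopf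
solution (ShellPincer*), the energy floor E ≥ ‖g‖²/‖∇g‖_∞ (EnergyFloor*), steady identities / cone /
condensate-necessary
(Steady*); ideas, triage and two checked skeleton lines under Cruxes/TwodBoundedEnergyZeroMomentum/.

KILL CRITERIA. TwohalfdNeg proved ⇒ `route close --reason refuted:TwohalfdThesis` (the class carries
no zeroth law; ¬X
follows from #5 along subsequences). ScalarAnomalySteadySourceFormal refuted ⇒ close refuted,
because X ⇒ #2 on paper: split
an X-witness as u_j = twoHalf v_j θ_j (Torus.eq_twoHalf_of_forall_add_single); v_j is a 2-D
Leray–Hopf solution by the 2-D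
energy equality, its dissipation → 0 at bounded energy
(Literature.Barriers.AnomalousDissipation.AlexakisDoering2006_energyDissipationBound),
so the scalar keeps ≥ ε/2 of the anomaly for large j. PLANAR PROBE (recorded, no longer an item): #2
needs ONE planar
Leray–Hopf family that has ν-uniformly bounded limsup-mean energy AND mixes; bounded energy is free
at nonzero momentum only by
Galilean detuning
(Literature.Barriers.AnomalousDissipation.exists_firstMode_boundedMeanEnergy_family: laminar swept
states,
scalar variance O(1), dissipation O(ν)) and is the printed open problem at zero momentum (CTV2013
p.3; first shell rigid in
tree). A theorem 'every zero-momentum Leray–Hopf family under every steady smooth g ≠ 0 has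
unbounded limsup-mean energy as
ν → 0' (¬ former #3; refuters may still land it under
Theorems/TwodBoundedEnergyZeroMomentum/Negative/) confines #2-witnesses
to momentum-carrying families; together with a swept-detuning no-go for the sourced scalar it
refutes #2 and the route closes
refuted/exhausted. A refutation of the support item SourcedScalarUnique2D (a NON-unique L^∞L² weak
scalar over a 2-D
Leray–Hopf drift, cf. BonicattoCiampaCrippa2023 Q5–Q6 for drifts only L² in time) would NOT kill the
line: repair by restating
#2 over energy-class scalars (ScalarLift2halfDR already quantifies the energy representative). A
junk-level refutation of
ScalarLift2halfDR or ScalarLiftGlueR (measure-theoretic side conditions) is repaired by restating,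
never closes the route. ZerothLaw proved by a 3-D route
moots the line; ¬ZerothLaw (route Neg) kills it.

NOT DECOMPOSED YET. (i) [DECOMPOSED at rev 6, repaired rev 9 — kept here for the record] the lift #2
→ #0 is the support chain
ScalarLiftGlueR ∘ (SourcedScalarUnique2D, ScalarLift2halfDR) (items 14323 + the two rev-9 items;
proof routes in their docstrings
and in the evidence file LIFT_CHAIN.md on 14324, read with v₀ replaced by the restart datum v s):
uniqueness makes ANY #2-witness
θ_j a.e.-in-time equal to the energy solution θ̃_j, and for a good time s_j the translated lift u_j
t := twoHalf (v_j (t+s_j))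
(θ̃_j (t+s_j)) with f := twoHalf g h and datum twoHalf (v_j s_j) (θ̃_j s_j) is a 3-D global
Leray–Hopf solution (in tree: Torus.twoHalf, IsSmooth.twoHalf,
IsDivFree.twoHalf, hasZeroMean_twoHalf, twoHalf_add_single, isWeaklyDivFree_twoHalf, memLp_twoHalf,
mFourierCoeff_comp_planarProj; models: the weak-Euler lift isAdmissibleWeakEulerOn_twoHalf /
weakIdentity_twoHalf and
Cheskidov's classical 2½-D family in CheskidovNoAnomalyLift.lean); meanEnergy ≤ E_v + E_θ by limsup
subadditivity
(junk-safe) and translation invariance of limsup means (LongTimeAverageShift: meanEnergy_translate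
for v_j; for the scalar
variance and dissipation longTimeAvgSup_comp_add_right, whose local-integrability input comes from
the weak class — Fubini on
PassiveScalarForcedClass.ae_memLp_two / aestronglyMeasurable_uncurry — and, for ν_j‖∇θ_j‖², from ε >
0 itself: a non-integrable
window would make every running mean the interval-integral junk 0); the delicate step stays the
Cesàro-BOUNDEDNESS of the lift's
dissipation (energy_ineq_zero + ⟨f,u⟩ ≤ ‖f‖_{Ḣ⁻¹}‖u‖_{Ḣ¹}, f mean-zero;
Torus.IsLerayHopfOn.intervalIntegral_power_bounds as in the
landed scalarLiftGlue_proof), without which meanDissipation would be the Real-limsup junk 0. Below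
the two item
layers nothing more is filed: helper lemmas (Ladyzhenskaya-in-time for Leray–Hopf fields, spectral
split eGradNormSq (twoHalf
V R) = eGradNormSq V + eScalarGradNormSq R for L² fields, Galerkin energy solution with L⁴ drift)
ride with `--supports`.
(ii) The choice of (g, h) — g on ≥ 2 shells — the mixing-rate hypotheses on v_j, and whether h must
be correlated with g; a
glued split of #2 into 'planar family with mixing property M' ∧ 'M ⇒ sourced-scalar anomaly at
bounded variance' is the
natural two-layer move ONCE a typed M is credible — bounded energy alone (former #3) is not such an
M, and no M is filed on
speculation. (iii) Momentum: X and #2 allow any L² data; zero momentum is where the planar energy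
bound is hard, nonzero
momentum is where mixing is hopeless (detuned swept response) — a #2-witness must resolve this
tension inside ONE family, which
is why the planar bound is no longer split off as an item.

CHEAPEST FALSIFIER. Single-shell planar forcing is already dead for #2 (ν-uniform planar H¹ bound at
bounded energy from the
Tran–Shepherd identity, TranShepherd2002 §4 / AlexakisDoering2006PLA §4, then renormalisation of the
sourced scalar against the
Sobolev limit drift: SINGLE_SHELL_2HALFD.md, E1SUBCASE_0211.md; in Lean for the velocity half:
ShellPincer —
single-shell witnesses dissipate O(ν_j)). The cheapest kill of the whole line is the TWO-shell
version of that estimate: a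
ν-uniform bound sup_j limsup-mean ‖∇v_j‖² < ∞ at bounded energy for g supported on two shells λ_a <
λ_b (the enstrophy balance
alone gives only λ_a⟨g,v⟩ ≤ ν⟨‖Δv‖²⟩ ≤ λ_b⟨g,v⟩, so this is a genuine question, not a lookup) would
renormalise every
admissible scalar and kill every trigonometric-polynomial witness of #2. Refuters: try it with the
tree's shell/band pincer
files (GravestModeLaminarAttractorShellPincer, GravestModeLaminarAttractorBandPincer) before
anything else; nothing numerical is
needed at this stage.

Novelty: Nearest prior art (lit search/frontier/vsearch): BrueDeLellis2023 (arXiv:2207.06301) Thm 1.1/3.1 —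
2½-D anomalous dissipation for forced 3-D NS with ν- AND time-dependent forces on [0,1]; their Q2.1
(ν-independent force) is open; Q2.2 (time-independent) was answered by arXiv:2409.03599 Thm 1.5
(Johansson–Sorella: autonomous non-weak-Sard C^α planar field; still ν-dependent forces/data on
[0,1]); the only long-time-average anomaly is Cheskidov2023 (arXiv:2311.04182) Thm 1.3, again 2½-D
with time-periodic ν-dependent f^ν → f; BCCDS2024 (arXiv:2212.08413): Onsager-critical, ν-dependent.
Scalar side: DrivasEtAl2022, arXiv:2305.05048, arXiv:2409.03599 Thm 1.1 (prescribed fields, unforced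
scalar); arXiv:1911.11014 (stochastic source, stochastic 2-D NS at FIXED ν, κ → 0); arXiv:2305.08090
(randomly forced NS with friction, only κ → 0). 2-D energy side: AlexakisDoering2006PLA §2;
ConstantinTarfuleaVicol2013 p.3 ('open problems'). DELTA: ONE steady smooth ν-INDEPENDENT force in
the stationary regime (limsup long-time means, ν-uniform mean energy) = BDL Q2.1 ∧ Q2.2 ∧
stationarity, isolated as two 2-D statements absent from print: a ν-uniform energy bound for
steadily forced 2-D NS (TwodBoundedEnergy), and anomalous dissipation of a STEADILY SOURCED passive
scalar advected by that NS family at Pr = 1, ν = κ → 0 together (ScalarAnomalySteadySourceFormal).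
Self-grade: new-combination (known 2½-D mechanism; new regime: steady source, NS-generated
velocities, stationary statistics, Pr = 1).  [refs: 2207.06301, 2409.03599, 2311.04182, 2212.08413, 2305.05048, 1911.11014, 2305.08090, BrueDeLellis2023, Cheskidov2023, BCCDS2024, DrivasEtAl2022, ConstantinTarfuleaVicol2013]

Barriers (technique_class: two-and-a-half-dimensional passive-scalar 2d-navier-stokes): technique_class: two-and-a-half-dimensional passive-scalar 2d-navier-stokes
- Literature.Barriers.AnomalousDissipation.AlexakisDoering2006_energyDissipationBound: APPLIES to
the planar velocity (ε_2D = O(Re^{-1/2}) at bounded U) and is USED, not evaded: all anomaly sits in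
the transported third component (the catalogued evasion, BrueDeLellis2023 §3).
- Literature.Barriers.AnomalousDissipation.DrivasElgindiIyerJeong2022_thm4 (Obukhov–Corrsin):
finite-window, unforced — not literally applicable to limsup means with a source; on windows it
forces the witness scalars to lose uniform C^β bounds (NS velocities near-Lipschitz in the enstrophy
cascade, α ≈ 1 ⇒ β → 0): a Batchelor-regime rough scalar is the bet; no theorem evades it.
- Literature.Barriers.AnomalousDissipation.Marchioro1986_globalAttraction: kills TwodBoundedEnergy
(hence the thesis) for first-shell eigenforces (laminar, energy ~ ν⁻²); evasion: g above the first
shell, where nothing is printed — the bet is a ν-independent condensate (GalletYoung2013),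
contested.
- Literature.Barriers.AnomalousDissipation.Cheskidov2023_thm13_not_forceRobustNoAnomaly: APPLIES to
the negative crux TwohalfdNeg — in this very class long-time anomaly holds for time-periodic
ν-dependent f^ν → f, so its proof must use exact steadiness + ν-independence of f (e.g. autonomous
weak-Sard rigidity, arXiv:2603.11466 Thm 1.2), never force-robust energy estimates.
- Literature.Barriers.AnomalousDissipation.BardosTitiWiedemann2012_thm5: parallel-shear p

History (route lifecycle, newest last):
- 2026-08-15T16:24:02Z · rev 4: restated TwodBoundedEnergy (stmt-AnomalousDissipation-0209), Assembly (stmt-AnomalousDissipation-0207) — route-repair (planner): (1) deciding theorem closes : TwohalfdThesis -> AnomalousDissipation (drop the two x3-invariance conjuncts; native check ok, std axioms) (planner-rbadge-AnomalousDissipation-TwoAndHalf-4cc4c4a8-g2-0)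
- 2026-08-15T16:24:02Z · rev 4: dropped ScalarAnomalySteadySource — route-repair (planner): (1) deciding theorem closes : TwohalfdThesis -> AnomalousDissipation (drop the two x3-invariance conjuncts; native check ok, std axioms) (planner-rbadge-AnomalousDissipation-TwoAndHalf-4cc4c4a8-g2-0)
- 2026-08-16T03:42:01Z · AUTO-CRUX (backfill): TwohalfdThesis — hypotheses of the deciding theorem that nothing in the route derives are cruxes (operator:999:586464)
- 2026-08-16T06:26:49Z · rev 8: dropped TwodBoundedEnergyZeroMomentum — @note.txt (planner-rrepair-AnomalousDissipation-TwoAndHal-2b6272a3-0)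
- 2026-08-16T06:39:59Z · BROKEN — ScalarLift2halfD (stmt-AnomalousDissipation-14324, support) refuted by Summit.AnomalousDissipation.AnomalousDissipation.Theorems.not_ScalarLift2halfD @ abe3197ba357 (prover-pitem-stmt-AnomalousDissipation-14324-0)
- 2026-08-16T07:03:43Z · rev 9: dropped ScalarLift2halfD, ScalarLiftGlue — route-choice (unit rchoice-AnomalousDissipation-TwoAndHal-211b03f8): NEXT LINE = same thesis, repaired crux→target glue chain. ScalarLift2halfD (stmt-14324) ref (planner-rchoice-AnomalousDissipation-TwoAndHal-211b03f8-0)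
- 2026-08-16T07:03:44Z · REPAIRED (drop ScalarLift2halfD, ScalarLiftGlue; add ScalarLift2halfDR, ScalarLiftGlueR) — back to open: route-choice (unit rchoice-AnomalousDissipation-TwoAndHal-211b03f8): NEXT LINE = same thesis, repaired crux→target glue chain. ScalarLift2halfD (stmt-14324) ref (planner-rchoice-AnomalousDissipation-TwoAndHal-211b03f8-0)

sub-problem: AnomalousDissipation · status: open · opened planner-AnomalousDissipation-Survey-0 2026-08-13T06:06:42Z · rev 9 · ledger route-AnomalousDissipation-TwoAndHalfD
GENERATED by the gate from the ledger (D-0016/17). Provers cite these decls: `theorem foo : Summit.AnomalousDissipation.AnomalousDissipation.Theses.TwoAndHalfD.<Decl> := …` in Summits/AnomalousDissipation/AnomalousDissipation/Theorems/<Name>.lean.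
-/

namespace Summit.AnomalousDissipation.AnomalousDissipation.Theses.TwoAndHalfD

open scoped BigOperators Topology Manifold Classical MeasureTheory ProbabilityTheory Matrix InnerProductSpace ComplexConjugate ContinuousMap
open Filter Set Function TopologicalSpace MeasureTheory

attribute [summit_statement] _root_.AnomalousDissipation

open Literature.Turb

/-- item stmt-AnomalousDissipation-0206 · crux (kind.auto-crux: conjecture-grade) · rank 0 · open · by planner
why it might fail: X = BrueDeLellis2023 Q2.1 (nu-independent f) + stationarity + nu-uniform energy in the x3-invariant class, whose planar flow has no energy anomaly (AlexakisDoering2006): needs BOTH a nu-uniform 2-D energy bound (0209; open, CTV2013 p.3) AND steady-source scalar anomaly at Pr=1 (0448). Negation 0211.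
sources: BrueDeLellis2023 (arXiv:2207.06301) Thm 1.1/3.1, p.5 Questions 2.1-2.2, arXiv:2409.03599 (Johansson-Sorella) Thm 1.5: time-independent but nu-dependent forces, window [0,1], arXiv:2311.04182 (Cheskidov2023) Thm 1.3: long-time anomaly with time-periodic nu-dependent forces, 2.5-D, AlexakisDoering2006PLA sec. 2 = Literature.Barriers.AnomalousDissipation.AlexakisDoering2006_energyDissipationBound, ConstantinTarfuleaVicol2013 (arXiv:1305.7089) p.3
ZerothLaw with f and every u_j t invariant under x ↦ x + s e₃ (UnitAddTorus (Fin 3) = Fin 3 →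
UnitAddCircle; Pi.single 2 s). Then u_j = (v_j, w_j): 2-D NS forced by (f₁,f₂) plus a passive scalar
w_j with steady source f₃ at Pr = 1; all anomaly sits in w_j (AlexakisDoering2006). Sources:
Lellis2023 (2½-D architecture), DEIJ2022, arXiv230505048, CelaniEtAl2000, GalletYoung2013. -/
@[route_item "route-AnomalousDissipation-TwoAndHalfD", crux]
def TwohalfdThesis : Prop :=
  ∃ f : UnitAddTorus (Fin 3) → EuclideanSpace ℝ (Fin 3), (∀ (s : UnitAddCircle) (x : UnitAddTorus (Fin 3)), f (x + Pi.single (2 : Fin 3) s) = f x) ∧ Literature.Analysis.FunctionSpaces.Torus.IsSmooth f ∧ Literature.Analysis.FunctionSpaces.Torus.IsDivFree f ∧ Literature.Analysis.FunctionSpaces.Torus.HasZeroMean f ∧ ∃ (ν : ℕ → ℝ) (u₀ : ℕ → UnitAddTorus (Fin 3) → EuclideanSpace ℝ (Fin 3)) (u : ℕ → ℝ → UnitAddTorus (Fin 3) → EuclideanSpace ℝ (Fin 3)), (∀ j, 0 < ν j) ∧ Filter.Tendsto ν Filter.atTop (nhds 0) ∧ (∀ j, Literature.Analysis.FluidPDE.Torus.IsGlobalLerayHopf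 (ν j) (fun _ => f) (u₀ j) (u j)) ∧ (∀ j (t : ℝ) (s : UnitAddCircle) (x : UnitAddTorus (Fin 3)), u j t (x + Pi.single (2 : Fin 3) s) = u j t x) ∧ (∃ E : ℝ, ∀ j, Literature.Analysis.FluidPDE.meanEnergy (u j) ≤ E) ∧ ∃ ε : ℝ, 0 < ε ∧ ∀ j, ε ≤ Literature.Analysis.FluidPDE.meanDissipation (ν j) (u j)

/-- item stmt-AnomalousDissipation-0448 · crux · rank 2 · open · by planner
why it might fail: v_j may condense to a near-autonomous large-scale state (GalletYoung2013); autonomous weak-Sard 2-D fields allow no dissipation anomaly (arXiv:2603.11466 Thm 1.2, arXiv:2409.03599 Rem 1.2) and relax only at rate kappa^(-1/3) (arXiv:2211.14057): <theta_j^2> ~ nu_j^(-a) or nu_j<|grad theta_j|^2> -> 0.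
sources: BrueDeLellis2023 (arXiv:2207.06301) Thm 3.1 + p.5 Q2.1-2.2: nearest print (nu- and t-dependent g, unforced theta, window [0,1]), arXiv:2409.03599 Thm 1.1 and 1.5, Remarks 1.2-1.4 (autonomous 2-D field; steady forced Euler state), arXiv:2603.11466 (Bagnara-Boutros-De Lellis-Mayboroda 2026) Thm 1.2, Conjecture 1.3, arXiv:1911.11014 (Bedrossian-Blumenthal-Punshon-Smith) sec. 1: stochastic source, stochastic 2-D NS at FIXED nu, kappa -> 0, arXiv:2211.14057 (Brue-Coti Zelati-Marconi): enhanced dissipation kappa^(-1/3) optimal for 2-D Hamiltonian flows, Literature.Barriers.AnomalousDissipation.DrivasElgindiIyerJeong2022_thm4 (Obukhov-Corrsin threshold)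
SUPERSEDES informal stmt-AnomalousDissipation-0208 now that defn-IsWeakScalarTransportForcedOn
LANDED (Literature/Analysis/FluidPDE/PassiveScalarForced.lean:
Literature.Analysis.FluidPDE.Torus.IsWeakScalarTransportForced κ u s θ₀ θ = ∀ T>0, …ForcedOn).
IMPORTS needed to elaborate: Literature.Analysis.FluidPDE.PassiveScalarForced (brings PassiveScalar:
scalarL2Sq, eScalarGradNormSq); checked rc 0 with that import +
Summits.AnomalousDissipation.Statement. Content: ∃ smooth div-free mean-zero g : T² → ℝ², smooth
mean-zero source h : T² → ℝ, ν_j → 0, 2-D global Leray–Hopf v_j (force g), L² data θ₀_j and global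
weak solutions θ_j of ∂ₜθ + v_j·∇θ = ν_jΔθ + h (Prandtl 1) with limsup-mean ‖v_j‖² and ‖θ_j‖²
bounded uniformly in j and limsup-mean ν_j‖∇θ_j‖² ≥ ε > 0 (spectral eScalarGradNormSq, toReal — same
convention as Turb.meanDissipation). This is the 2-D-language core of thesis B0: the lift
u_j(x₁,x₂,x₃) = (v_j, θ_j), f = (g, h) is x₃-invariant, div-free, mean-zero, and eGradNormSq u =
eGradNormSq v + eScalarGradNormSq θ. DELIBERATELY NOT DECOMPOSED: the glue B2' → B0 (lifted pair is
a 3-D global LH solution: needs the scalar energy inequalities for θ_j — automatic here since 2-D LH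
v_j -/
@[route_item "route-AnomalousDissipation-TwoAndHalfD", crux]
def ScalarAnomalySteadySourceFormal : Prop :=
  ∃ (g : UnitAddTorus (Fin 2) → EuclideanSpace ℝ (Fin 2)) (h : UnitAddTorus (Fin 2) → ℝ), Literature.Analysis.FunctionSpaces.Torus.IsSmooth g ∧ Literature.Analysis.FunctionSpaces.Torus.IsDivFree g ∧ Literature.Analysis.FunctionSpaces.Torus.HasZeroMean g ∧ Literature.Analysis.FunctionSpaces.Torus.IsSmooth h ∧ Literature.Analysis.FunctionSpaces.Torus.HasZeroMean h ∧ ∃ (ν : ℕ → ℝ) (v₀ : ℕ → UnitAddTorus (Fin 2) → EuclideanSpace ℝ (Fin 2)) (v : ℕ → ℝ → UnitAddTorus (Fin 2) → EuclideanSpace ℝ (Fin 2)) (θ₀ : ℕ → UnitAddTorus (Fin 2) → ℝ) (θ : ℕ → ℝ → UnitAddTorus (Fin 2) → ℝ), (∀ j, 0 < ν j) ∧ Filter.Tendsto ν Filter.atTop (nhds 0) ∧ (∀ j, Literature.Analysis.FluidPDE.Torus.IsGlobalLerayHopf (ν j) (fun _ => g) (v₀ j) (v j)) ∧ (∀ j,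 MeasureTheory.MemLp (θ₀ j) 2 MeasureTheory.volume) ∧ (∀ j, Literature.Analysis.FluidPDE.Torus.IsWeakScalarTransportForced (ν j) (v j) (fun _ => h) (θ₀ j) (θ j)) ∧ (∃ E : ℝ, ∀ j, Literature.Analysis.FluidPDE.meanEnergy (v j) ≤ E) ∧ (∃ E : ℝ, ∀ j, Literature.Analysis.FluidPDE.longTimeAvgSup (fun t => Literature.Analysis.FluidPDE.Torus.scalarL2Sq (θ j t)) ≤ E) ∧ ∃ ε : ℝ, 0 < ε ∧ ∀ j, ε ≤ Literature.Analysis.FluidPDE.longTimeAvgSup (fun t => ν j * (Literature.Analysis.FluidPDE.Torus.eScalarGradNormSq (θ j t)).toReal)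

/-- item stmt-AnomalousDissipation-0211 · crux · rank 5 · open · by planner
why it might fail: False iff X (0206) holds, e.g. steady forcing sustaining a non-weak-Sard planar mixing state; nu-dependent-force anomalies exist in this class (arXiv:2409.03599 Thm 1.5 on [0,1]; Cheskidov2023 Thm 1.3, long-time, time-periodic f^nu -> f), so a proof must use exact steadiness + nu-independence of f.
sources: arXiv:2409.03599 Thm 1.5 and Rem 1.4, arXiv:2311.04182 (Cheskidov2023) Thm 1.3 = Literature.Barriers.AnomalousDissipation.Cheskidov2023_thm13_not_forceRobustNoAnomaly, arXiv:2603.11466 Thm 1.2 / Conj 1.3 (rigidity supporting the claim for autonomous planar states), AlexakisDoering2006PLA sec. 2 (velocity half: eps_2D = O(Re^(-1/2)) at bounded U)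
Shared with route Neg (#3 there). Plausible mechanism: 2-D base flow condenses to a near-steady
state whose streamline-averaged scalar source is not annihilated ⇒ scalar energy blows up unless
dissipation is merely enhanced, not anomalous. -/
@[route_item "route-AnomalousDissipation-TwoAndHalfD"]
def TwohalfdNeg : Prop :=
  ∀ f : UnitAddTorus (Fin 3) → EuclideanSpace ℝ (Fin 3), (∀ (s : UnitAddCircle) (x : UnitAddTorus (Fin 3)), f (x + Pi.single (2 : Fin 3) s) = f x) → Literature.Analysis.FunctionSpaces.Torus.IsSmooth f → Literature.Analysis.FunctionSpaces.Torus.IsDivFree f → Literature.Analysis.FunctionSpaces.Torus.HasZeroMean f → ∀ (ν : ℕ → ℝ) (u₀ : ℕ → UnitAddTorus (Fin 3) → EuclideanSpace ℝ (Fin 3)) (u : ℕ → ℝ → UnitAddTorus (Fin 3) → EuclideanSpace ℝ (Fin 3)), (∀ j, 0 < ν j) → Filter.Tendsto ν Filter.atTop (nhds 0) → (∀ j, Literature.Analysis.FluidPDE.Torus.IsGlobalLerayHopf (ν j) (fun _ => f) (u₀ j) (u j)) → (∀ j (t : ℝ) (s : UnitAddCircle) (x : UnitAddTorus (Fin 3)),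 u j t (x + Pi.single (2 : Fin 3) s) = u j t x) → (∃ E : ℝ, ∀ j, Literature.Analysis.FluidPDE.meanEnergy (u j) ≤ E) → Filter.Tendsto (fun j => Literature.Analysis.FluidPDE.meanDissipation (ν j) (u j)) Filter.atTop (nhds 0)

/-- item stmt-AnomalousDissipation-0210 · support · rank 4 · closed · proved by Summit.AnomalousDissipation.AnomalousDissipation.Theorems.symmetricLhExistence_proof (prover) · by planner
Galerkin scheme restricted to the closed invariant subspace (translations along e₃ commute with
Leray projector, Laplacian and the Galerkin projections), or glue 2-D LH v with the scalar w.
Standard; cf. Lellis2023 §2 for the 2½-D structure. -/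
@[route_item "route-AnomalousDissipation-TwoAndHalfD"]
def SymmetricLhExistence : Prop :=
  ∀ (ν : ℝ) (f u₀ : UnitAddTorus (Fin 3) → EuclideanSpace ℝ (Fin 3)), 0 < ν → Literature.Analysis.FunctionSpaces.Torus.IsSmooth f → Literature.Analysis.FunctionSpaces.Torus.IsDivFree f → (∀ (s : UnitAddCircle) (x : UnitAddTorus (Fin 3)), f (x + Pi.single (2 : Fin 3) s) = f x) → MeasureTheory.MemLp u₀ 2 MeasureTheory.volume → Literature.Analysis.FunctionSpaces.Torus.IsWeaklyDivFree u₀ → (∀ (s : UnitAddCircle) (x : UnitAddTorus (Fin 3)), u₀ (x + Pi.single (2 : Fin 3) s) = u₀ x) → ∃ u : ℝ → UnitAddTorus (Fin 3) → EuclideanSpace ℝ (Fin 3), Literature.Analysis.FluidPDE.Torus.IsGlobalLerayHopf ν (fun _ => f) u₀ u ∧ ∀ (t : ℝ) (s : UnitAddCircle) (x : UnitAddTorus (Fin 3)), u t (x + Pi.single (2 : Fin 3) s) = u t x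

/-- item stmt-AnomalousDissipation-14323 · support · rank 9 · closed · proved by Summit.AnomalousDissipation.AnomalousDissipation.Theorems.sourcedScalarUnique2D_proof @ 260a17bbe4c1 (prover) · by planner
sources: BonicattoCiampaCrippa2023 (arXiv:2306.15529) Thm 2.7, §3, Q5-Q6, DiPernaLions1989 §II.1, LadyzhenskayaSolonnikovUraltseva1968 Ch. III
[support] UNIQUENESS OF WEAK SOURCED SCALARS OVER A 2-D LERAY–HOPF DRIFT (the uniqueness half of the
foreseen 'SourcedScalarWellPosed2D', NOT DECOMPOSED YET §(i); makes ANY #2-witness θ_j a.e. equal to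
the energy solution). For ν > 0, any T, any 2-D global Leray–Hopf velocity v
(Torus.IsGlobalLerayHopf ν (fun _ => g) v₀ v; no hypothesis on g, h, θ₀ is needed) and two weak
solutions θ₁, θ₂ ∈ L^∞_t L²_x of ∂ₜθ + v·∇θ = νΔθ + h on [0,T) with the same datum and source
(Torus.IsWeakScalarTransportForcedOn T ν v (fun _ => h) θ₀ θᵢ): θ₁ t = θ₂ t a.e. in x for a.e. t ∈
(0,T) (T ≤ 0 is vacuous). PROOF ROUTE (duality; every ingredient standard): w := θ₁ − θ₂ satisfies
the homogeneous weak identity with zero datum and vw ∈ L¹; v ∈ L^∞(0,T;L²) ∩ L²(0,T;Ḣ¹)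
(energy_bound, memL2Sobolev) ⊂ L⁴((0,T)×T²) by the 2-D Ladyzhenskaya inequality (tree:
Torus.ladyzhenskayaConst₂, NSUniqueness2HalfD) — the critical Prodi–Serrin class 2/4 + 2/4 = 1;
mollify v → v_ε in space-time (smooth, div-free, ‖v_ε‖_{L⁴} ≤ ‖v‖_{L⁴}, v_ε → v in L⁴); for φ ∈
C_c^∞((0,T)×T²) solve the BACKWARD ADJOINT ∂ₜψ + v_ε·∇ψ + νΔψ = −φ, ψ = 0 on [T−δ, ∞), by time
reversal of the PROVED classical well-posedness Torus.exists_unique_isC -/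
@[route_item "route-AnomalousDissipation-TwoAndHalfD"]
def SourcedScalarUnique2D : Prop :=
  ∀ (T ν : ℝ) (g : UnitAddTorus (Fin 2) → EuclideanSpace ℝ (Fin 2)) (h : UnitAddTorus (Fin 2) → ℝ) (v₀ : UnitAddTorus (Fin 2) → EuclideanSpace ℝ (Fin 2)) (v : ℝ → UnitAddTorus (Fin 2) → EuclideanSpace ℝ (Fin 2)) (θ₀ : UnitAddTorus (Fin 2) → ℝ) (θ₁ θ₂ : ℝ → UnitAddTorus (Fin 2) → ℝ), 0 < ν → Literature.Analysis.FluidPDE.Torus.IsGlobalLerayHopf ν (fun _ => g) v₀ v → Literature.Analysis.FluidPDE.Torus.IsWeakScalarTransportForcedOn T ν v (fun _ => h) θ₀ θ₁ → Literature.Analysis.FluidPDE.Torus.IsWeakScalarTransportForcedOn T ν v (fun _ => h) θ₀ θ₂ → ∀ᵐ t ∂(MeasureTheory.volume.restrict (Set.Ioo 0 T)), θ₁ t =ᵐ[MeasureTheory.volume] θ₂ t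

/-- item stmt-AnomalousDissipation-14983 · support · rank 9 · closed · proved by Summit.AnomalousDissipation.AnomalousDissipation.Theorems.scalarLift2halfDR_proof @ 54ff05d9b0e1 (prover) · by planner
sources: BrueDeLellis2023 (arXiv:2207.06301) §3, (5.4), Cheskidov2023 (arXiv:2311.04182) §3 (3.7)-(3.13), Lemma 3.2, MajdaBertozzi2002 §2.3.1, RobinsonRodrigoSadowski2016 Def. 4.9, p. 131, DiPernaLions1989 §II.1-II.3, LionsMagenes1972 Ch. 3
[support] REPAIRED 2½-D LIFT, RESTART FORM (successor of ScalarLift2halfD =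
stmt-AnomalousDissipation-14324, refuted-MISSTATED by Theorems.not_ScalarLift2halfD: a
non-measurable junk planar datum v₀ satisfies Torus.IsGlobalLerayHopf, whose fields see v₀ only
through Bochner integrals and a lower integral). For ν > 0, g smooth divergence-free, h smooth, θ₀ ∈
L²(T²) and a 2-D global Leray–Hopf v with force g from ANY datum v₀: (a) there is a global weak
solution θ of ∂ₜθ + v·∇θ = νΔθ + h, θ(0) = θ₀ (Torus.IsWeakScalarTransportForced ν v (fun _ => h) θ₀
θ) — take the ENERGY solution, θ ∈ C([0,∞);L²) ∩ L²_loc H¹ with the energy equality between any two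
times; and (b) for SOME s ≥ 0 the translated lift t ↦ twoHalf (v (t+s)) (θ (t+s)) = (v, θ)(t+s)∘π is
a 3-D GLOBAL LERAY–HOPF solution with viscosity ν, steady force twoHalf g h and the HONEST datum
twoHalf (v s) (θ s) (both slices are L²: IsLerayHopfOn.memLp, continuity of θ). PROOF ROUTE: (1) θ:
regularisation scheme of PassiveScalarReleaseExistence.exists_isWeakScalarTransportOn_of_sq
(L^∞_tL²_x drift; add the smooth steady source via
Torus.exists_unique_isClassicalScalarTransportForcedOn_holds for the regularised problems), energy
cla -/
@[route_item "route-AnomalousDissipation-TwoAndHalfD"]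
def ScalarLift2halfDR : Prop :=
  ∀ (ν : ℝ) (g : UnitAddTorus (Fin 2) → EuclideanSpace ℝ (Fin 2)) (h : UnitAddTorus (Fin 2) → ℝ) (v₀ : UnitAddTorus (Fin 2) → EuclideanSpace ℝ (Fin 2)) (v : ℝ → UnitAddTorus (Fin 2) → EuclideanSpace ℝ (Fin 2)) (θ₀ : UnitAddTorus (Fin 2) → ℝ), 0 < ν → Literature.Analysis.FunctionSpaces.Torus.IsSmooth g → Literature.Analysis.FunctionSpaces.Torus.IsDivFree g → Literature.Analysis.FunctionSpaces.Torus.IsSmooth h → MeasureTheory.MemLp θ₀ 2 MeasureTheory.volume → Literature.Analysis.FluidPDE.Torus.IsGlobalLerayHopf ν (fun _ => g) v₀ v → ∃ θ : ℝ → UnitAddTorus (Fin 2) → ℝ, Literature.Analysis.FluidPDE.Torus.IsWeakScalarTransportForced ν v (fun _ => h) θ₀ θ ∧ ∃ s : ℝ, 0 ≤ s ∧ Literature.Analysis.FluidPDE.Torus.IsGlobalLerayHopf ν (fun _ => Literature.Analysis.FunctionSpaces.Torus.twoHalf g h) (Literature.Analysis.FunctionSpaces.Torus.twoHalf (v s)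 (θ s)) (fun t => Literature.Analysis.FunctionSpaces.Torus.twoHalf (v (t + s)) (θ (t + s)))

/-- item stmt-AnomalousDissipation-14984 · support · rank 9 · closed · proved by Summit.AnomalousDissipation.AnomalousDissipation.Theorems.scalarLiftGlueR_proof @ dd4a28b5bfdc (prover) · by planner
sources: BrueDeLellis2023 (arXiv:2207.06301) §3, Cheskidov2023 (arXiv:2311.04182) Lemma 3.2, DoeringFoias2002 §2, FoiasManleyRosaTemam2001 Ch. II (7.16)-(7.20)
[support] REPAIRED GLUE crux #2 → target (successor of ScalarLiftGlue =
stmt-AnomalousDissipation-14325, proved by Theorems.scalarLiftGlue_proof but vacuous since its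
hypothesis ScalarLift2halfD is refuted): ScalarAnomalySteadySourceFormal → SourcedScalarUnique2D →
ScalarLift2halfDR → TwohalfdThesis. PROOF ROUTE (M; the landed
Theorems/TwoAndHalfDScalarLiftGlue.lean plus translation bookkeeping, no PDE): take the #2 witness
(g, h, ν, v₀, v, θ₀, θ, E_v, E_θ, ε) — NB v₀ j may be junk (non-measurable), never read it. For each
j, ScalarLift2halfDR gives θ̃_j (weak sourced solution from θ₀ j over v j) and s_j ≥ 0 with u_j :=
fun t => twoHalf (v j (t+s_j)) (θ̃_j (t+s_j)) global Leray–Hopf from u₀ j := twoHalf (v j s_j) (θ̃_j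
s_j); SourcedScalarUnique2D ON THE ORIGINAL AXIS (same datum θ₀ j, same drift v j; its Leray–Hopf
hypothesis is used only through fields on (0,T), junk datum harmless) gives θ̃_j t =ᵐ θ_j t for a.e.
t > 0, hence also θ̃_j (t+s_j) =ᵐ θ_j (t+s_j) for a.e. t > 0. WITNESS of X: f := twoHalf g h
(x₃-invariant: Torus.twoHalf_add_single; IsSmooth.twoHalf, IsDivFree.twoHalf, hasZeroMean_twoHalf
from g, h mean zero), ν, u₀, u as above (u_j t invariant for every t by twoHalf_a -/
@[route_item "route-AnomalousDissipation-TwoAndHalfD"]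
def ScalarLiftGlueR : Prop :=
  ScalarAnomalySteadySourceFormal → SourcedScalarUnique2D → ScalarLift2halfDR → TwohalfdThesis

-- earlier Assembly (stmt-AnomalousDissipation-0207, replaced 2026-08-15T16:24:02Z -> stmt-AnomalousDissipation-10787): retired by None — (∃ f : UnitAddTorus (Fin 3) → EuclideanSpace ℝ (Fin 3), (∀ (s : UnitAddCircle) (x : UnitAddTorus (Fin 3)), f (x + Pi.single (2 : Fin 3) s) = f x) ∧ Literature.Analysis.FunctionSpaces.Torus.IsSmooth f ∧ Literature.Analysis.FunctionSpaces.Torus.IsDivFree f ∧ Literatu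
/-- item stmt-AnomalousDissipation-10787 · assembly · rank 1 · closed · proved by Summit.AnomalousDissipation.AnomalousDissipation.Theorems.twoAndHalfDAssembly_proof (prover) · by planner
X → AnomalousDissipation: drop the two x₃-invariance conjuncts of TwohalfdThesis (the deciding
theorem `closes` proves exactly this implication, D-0027 §2.1; the assembly now names the target
item instead of inlining its body — clears the glue.extra-hypothesis stamp). -/
@[route_item "route-AnomalousDissipation-TwoAndHalfD"]
def Assembly : Prop :=
  TwohalfdThesis → _root_.AnomalousDissipation

-- records of items no longer active in this route (dropped / restated):
-- earlier TwodBoundedEnergy (stmt-AnomalousDissipation-0209, replaced 2026-08-15T16:24:02Z -> stmt-AnomalousDissipation-10786): retired by None — ∃ g : UnitAddTorus (Fin 2) → EuclideanSpace ℝ (Fin 2), Literature.Analysis.FunctionSpaces.Torus.IsSmooth g ∧ Literature.Analysis.FunctionSpaces.Torus.IsDivFree g ∧ Literature.Analysis.FunctionSpaces.Torus.HasZeroMean g ∧ g ≠ 0 ∧ ∃ (ν : ℕ → ℝ) (v₀ : ℕ → Uni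
-- earlier ScalarLift2halfD (stmt-AnomalousDissipation-14324, dropped 2026-08-16T07:03:43Z): refuted by Summit.AnomalousDissipation.AnomalousDissipation.Theorems.not_ScalarLift2halfD @ abe3197ba357 — ∀ (ν : ℝ) (g : UnitAddTorus (Fin 2) → EuclideanSpace ℝ (Fin 2)) (h : UnitAddTorus (Fin 2) → ℝ) (v₀ : UnitAddTorus (Fin 2) → EuclideanSpace ℝ (Fin 2)) (v : ℝ → UnitAddTorus (Fin 2) → EuclideanSpace ℝ (Fin
-- earlier ScalarLiftGlue (stmt-AnomalousDissipation-14325, dropped 2026-08-16T07:03:43Z): proved by Summit.AnomalousDissipation.AnomalousDissipation.Theorems.scalarLiftGlue_proof @ c0ce4818bb7f — ScalarAnomalySteadySourceFormal → SourcedScalarUnique2D → ScalarLift2halfD → TwohalfdThesis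

/-! D-0027 §2.1 — DECIDING THEOREM (planner-authored via `route open/edit --closes-file`; by planner-rbadge-AnomalousDissipation-TwoAndHalf-4cc4c4a8-g2-0 2026-08-15T16:24:02Z):
its hypotheses are this route's items and its conclusion the sub-problem Statement (glue_lint), and it elaborates with this file. -/

@[closes "route-AnomalousDissipation-TwoAndHalfD"] theorem closes : TwohalfdThesis → _root_.AnomalousDissipation := by
  rintro ⟨f, -, hfs, hfd, hfm, ν, u₀, u, hν, hν0, hLH, -, hE, hε⟩
  exact ⟨f, hfs, hfd, hfm, ν, u₀, u, hν, hν0, hLH, hE, hε⟩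

end Summit.AnomalousDissipation.AnomalousDissipation.Theses.TwoAndHalfD
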